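import Literature.NumberTheory.Rogawski1990.ArchEndoscopicTorusTransferIdentity      -- ★ 3Z FILE (β) p841876: the torus identity along B-p12's curve (brings ★ (β₀), ★ (E1), ★ (3H), ★ (3R), ★ (α), ★ (R3-a))
import Literature.NumberTheory.Automorphic.ArchEndoscopicCentralDescentRegular       -- ★ (3D) p841544: the descent to the centre under the `G`-regular hypothesis (brings ★ (E2) p841432 §2)
import Literature.NumberTheory.Rogawski1990.ArchEndoscopicTwoBlockTestFunction       -- ★ (3A′) p841779: the 2-block test function `Θ₂`, the centre identifications
import Literature.NumberTheory.Rogawski1990.ArchEndoscopicCentralCurveOrbitalSmooth  -- ★ (3G♭) p841759∕FILE 2: `exists_flat_gSide_centralCurve_of_archSmooth` (brings ★ (3G) p841608)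
import Literature.NumberTheory.Rogawski1990.ArchExplicitTransferFactorCongruence     -- ★ (3T-b) (F0P3a-p05 (g12)): `archExplicitDelta_archCongrOfEq` (`Δ″_∞` is congruence-covariant)
import Literature.NumberTheory.Rogawski1990.ArchCentralValueTransferDiagonal         -- ★ p841718: `exists_formCongr_eq_diagonal` (brings ★ `ArchCongruenceTransport`: the guards along `P`)
import Literature.NumberTheory.Rogawski1990.ArchSmoothCongruence                     -- ★ (T-d) FILE 4: `ArchSmooth.comp_archCongr`
import Literature.NumberTheory.Rogawski1990.ArchTransfersSingularOfCanonical         -- ★ the vocabulary of `stub_ScCore` (`ArchTransfersExistCanonical`'s thirteen conjuncts)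
import HarnessLib

/-!
# Lemma 14.5.2 (c) at `∞` — (S-c) CENTRAL VANISHING: for a thirteen-conjunct system at `(L, H′)` on the ray of Rogawski's explicit factor, the `Δ′_∞`-transfer `aH` of a smooth `a′`
# VANISHES at the rational central elements `γ_H = (ζ•1₂, ζ•1₁)` of `H_∞` (Rogawski 1990, §14.5 Lemma 14.5.2 (c), p. 238)

Topic `NumberTheory/Rogawski1990`; namespace `Literature.NumberTheory.Rogawski1990`.  THEOREMS ONLY (no `def`, no instance, no notation, no axiom, no named fact, no `sorry`).
Cell `pub/hodgecm-mathlib`, ENGINE T1 (crux H413 = `stmt-HodgeConjecture-24833`); ROAD-Sd residual R3: this file's head **`archDeltaTransfer_apply_center_eq_zero`** has EXACTLY the type of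
`stub_ScCore` of the registered line `Cruxes/H413/Lines/F0_P3a_SdArch.lean` (:37–:188, VERBATIM) — the by-name pay-down of that stub (3Z = the assembly of the STEP-3 integration map
`CENSUS-R3-STEP3-Integration.F0P3a-p03g10.md`, pen of record F0P3a-p03; LEAD WORDS T8-76 (C), T8-86, T8-92 (1), T8-97); author F0P3a-p03 (g11), 2026-09-01.
HONEST LABEL: HC_CM is proved only modulo the 7 printed citations until rung 0 closes; this file closes ONE registered stub of a pay-down line and is count-neutral for the books.

THE PROOF (Rogawski p. 238: «Let `γ ∈ Z`. … the germs of the functions `Φ(γ′, f)` … at a place `v ∈ S₀` where `G′_v` is compact … `D_G(γ′)Φ(γ′, f′) → 0` … hence `f^H(γ) = 0`»), as assembled here: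
1. DIAGONAL FRAME.  `H′` hermitian anisotropic ⇒ a rational frame `ᵗ(c̄P) H′ P = diagonal α′` (★ `exists_formCongr_eq_diagonal`); the guards move along `P` (★ `transpose_map_formCongr_cm`,
   ★ `anisotropic_formCongr_cm`, ★ `exists_posDef_formCongr_cm` — a DEFINITE place `w₀` of `diagonal α′` from `hP`); `Φ_P : U(diagonal α′)_∞ ≃ₜ* U(H′)_∞` (★ FILE 1 `coe_archCongrOfEq_apply`)
   carries `ν′ ↦ Φ_P⁻¹_*ν′` (Haar), `a′ ↦ a′ ∘ Φ_P` (★ FILE 4 `ArchSmooth.comp_archCongr`) and the ray: `(T.comap Φ_P).Δ = c · Δ″_∞^{diagonal α′}` (★ (3T-b) `archExplicitDelta_archCongrOfEq`).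
2. THE 2-BLOCK.  `Ψ = Φ_{Q₂} : U(Φ₂)_∞ ≃ₜ* U(diag(½,−½))_∞` (★ (R3-a)), per-place Haar measures `ν_w`, and ★ (3A′) `ArchSmooth₂.exists_contDiff_twoBlock`: an ambient smooth `Θ₂` on `M₂(L ⊗ ℝ)`,
   compactly supported on the group, with `Θ₂ ↑↑k = aH (Ψ⁻¹ k, δ)`, `δ = (ζ•1₁) ⊗ 1 = e₁⁻¹(w ↦ diag(σ_w ζ))` (★ `cmRationalToArch_one_eq_symm_circleDiagonal_of_coe_eq_smul_one`); the centre
   `(ζ•1₂) ⊗ 1` sits at the constant torus point `(σ_w ζ, σ_w ζ)_w` (★ `congr_cmRationalToArch_two_eq_archDiagTorus_of_coe_eq_smul_one`), so the claim is `Θ₂(centre) = 0`.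
3. DESCENT.  ★ (3D) `apply_center_eq_zero_of_forall_sum_integral_pi_eq_zero_of_ne_center` at `S₀ = univ ∖ w₀`: it remains to see `Σ_ε ∫ Θ₂ d(⊗ M(univ ∖ w₀, u, ε)) = 0` for every `u`
   `G`-regular off `w₀`; this is ★ (E2) §2 `sum_integral_pi_erase_eq_zero_of_eventuallyEq` at `S = univ, w₁ = w₀` along the central curve `u_ψ = u[w₀ ↦ (σζ e^{iψ}, σζ e^{−iψ})]`, whose
   hypothesis `heq` with the flat `r = κ⁻¹ • r_{G′}` is: ★ (β) `sum_integral_pi_eq_inv_mul_finsum_delta_comap_archSingularCurve` (the torus identity = ★ (3H)-univ ∘ ★ (E1) ∘ ★ (α), binders from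
   ★ (3R)) rewriting `Σ_ε ∫ Θ₂ d(⊗ M(univ, u_ψ, ε))` as `κ⁻¹ ·` the `Δ′`-weighted Haar class sum of `a′ ∘ Φ_P` at B-p12's lifted curve point `γ_H(ψ)` on `U(diagonal α′)_∞`, and ★ (3G♭)
   `exists_flat_gSide_centralCurve_of_archSmooth` (F0P3a-p05): `(2 sin ψ) •` that class sum is a flat `r_{G′}` near `ψ = 0` because `w₀` is a definite place.

## References
* [Rogawski1990] J. D. Rogawski, *Automorphic Representations of Unitary Groups in Three Variables*, Ann. of Math. Stud. 123 (1990), §14.5 Lemma 14.5.2 (c) p. 238; §4.3 (4.3.1) p. 43;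
  §8.4 pp. 126–127 (the limit formula); §14.3 pp. 233–234; §14.4 p. 237.
* [Shelstad1979] D. Shelstad, *Characters and inner forms of a quasi-split group over ℝ*, Compositio Math. 39 (1979), Thm. 4.7.
* [Varadarajan1989] V. S. Varadarajan, *An Introduction to Harmonic Analysis on Semisimple Lie Groups* (1989), §6.4 Thm. 22.
-/

set_option autoImplicit false

noncomputable section

open MeasureTheory Measure NumberField NumberField.InfinitePlace NumberField.mixedEmbedding IsDedekindDomain Filter Topology Set
open Literature.MeasureTheory.Group Literature.NumberTheory.Automorphic Literature.NumberTheory.GaloisRepresentations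
open Literature.AlgebraicGeometry.ShimuraVarieties (unitaryGroup hermForm)
open scoped Matrix MatrixGroups ComplexOrder ContDiff

namespace Literature.NumberTheory.Rogawski1990

/-! ## §0 Small facts -/

/-- A `Fin 3`-indexed family with pairwise distinct values is injective. [folklore] -/
private theorem injective_of_pairwise_ne_three {β : Type*} {f : Fin 3 → β} (h01 : f 0 ≠ f 1) (h02 : f 0 ≠ f 2) (h12 : f 1 ≠ f 2) : Function.Injective f := by
  intro i j hij
  fin_cases i <;> fin_cases j
  · rfl
  · exact absurd hij h01
  · exact absurd hij h02
  · exact absurd hij.symm h01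
  · rfl
  · exact absurd hij h12
  · exact absurd hij.symm h02
  · exact absurd hij.symm h12
  · rfl

/-! ## §1 (S-c): the central vanishing -/

set_option maxHeartbeats 1000000 in -- one `whnf` during the assembly of the ★ (3G♭) application exceeds the default budget (whole proof elaborates in < 30 s)
open scoped Classical in
/-- **LEMMA 14.5.2 (c) AT `∞` — (S-c) CENTRAL VANISHING** (the type of `stub_ScCore` of `Cruxes/H413/Lines/F0_P3a_SdArch.lean`, VERBATIM): for every CM field `L`, hermitian anisotropic `H′` with
a definite complex place, an archimedean transfer factor `T` on the ray `T.Δ = c · Δ″_∞` (`c ≠ 0`, `μ` unitary), Haar measures `ν′, ν, νH` and every thirteen-conjunct system `(m′, m, mH, t′, t, tH)`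
(texts of ★ `ArchTransfersExistCanonical`): if `aH ∈ C_c^∞(H_∞)`, `a′ ∈ C_c^∞(G′_∞)` and `IsArchDeltaTransfer L H′ T mH m′ aH a′` ((vi)), then `aH((ζ•1₂) ⊗ 1, (ζ•1₁) ⊗ 1) = 0` for every rational
central `γ_H = (ζ•1₂, ζ•1₁)`.  Proof = the module docstring's steps 1–3 (diagonal frame; 2-block test function; descent ★ (3D) fed by ★ (E2) §2, ★ (β), ★ (3G♭)).
[cite: Rogawski1990, §14.5 Lemma 14.5.2 (c) p. 238; §8.4] [cite: Shelstad1979, Thm. 4.7] -/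
theorem archDeltaTransfer_apply_center_eq_zero :
  ∀ (L : Type) [Field L] [NumberField L] [IsCMField L] (H' : Matrix (Fin 3) (Fin 3) L) (T : ArchTransferFactor L H')
  [MeasurableSpace (UnitaryGroup.arch (↥(maximalRealSubfield L)) L (IsCMField.complexConj L) 3 H')]
  [BorelSpace (UnitaryGroup.arch (↥(maximalRealSubfield L)) L (IsCMField.complexConj L) 3 H')]
  [MeasurableSpace (UnitaryGroup.arch (↥(maximalRealSubfield L)) L (IsCMField.complexConj L) 3
    (Matrix.of fun i j : Fin 3 => if i.val + j.val + 1 = 3 then (1 : L) else 0))]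
  [BorelSpace (UnitaryGroup.arch (↥(maximalRealSubfield L)) L (IsCMField.complexConj L) 3
    (Matrix.of fun i j : Fin 3 => if i.val + j.val + 1 = 3 then (1 : L) else 0))]
  [MeasurableSpace (UnitaryGroup.arch (↥(maximalRealSubfield L)) L (IsCMField.complexConj L) 2
          (Matrix.of fun i j : Fin 2 => if i.val + j.val + 1 = 2 then (1 : L) else 0) ×
        UnitaryGroup.arch (↥(maximalRealSubfield L)) L (IsCMField.complexConj L) 1
          (Matrix.of fun i j : Fin 1 => if i.val + j.val + 1 = 1 then (1 : L) else 0))]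
  [BorelSpace (UnitaryGroup.arch (↥(maximalRealSubfield L)) L (IsCMField.complexConj L) 2
          (Matrix.of fun i j : Fin 2 => if i.val + j.val + 1 = 2 then (1 : L) else 0) ×
        UnitaryGroup.arch (↥(maximalRealSubfield L)) L (IsCMField.complexConj L) 1
          (Matrix.of fun i j : Fin 1 => if i.val + j.val + 1 = 1 then (1 : L) else 0))]
  (ν' : Measure (UnitaryGroup.arch (↥(maximalRealSubfield L)) L (IsCMField.complexConj L) 3 H'))
  (ν : Measure (UnitaryGroup.arch (↥(maximalRealSubfield L)) L (IsCMField.complexConj L) 3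
    (Matrix.of fun i j : Fin 3 => if i.val + j.val + 1 = 3 then (1 : L) else 0)))
  (νH : Measure (UnitaryGroup.arch (↥(maximalRealSubfield L)) L (IsCMField.complexConj L) 2
          (Matrix.of fun i j : Fin 2 => if i.val + j.val + 1 = 2 then (1 : L) else 0) ×
        UnitaryGroup.arch (↥(maximalRealSubfield L)) L (IsCMField.complexConj L) 1
          (Matrix.of fun i j : Fin 1 => if i.val + j.val + 1 = 1 then (1 : L) else 0)))
  [ν'.IsHaarMeasure] [ν'.IsMulRightInvariant] [ν.IsHaarMeasure] [ν.IsMulRightInvariant]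
  [νH.IsHaarMeasure] [νH.IsMulRightInvariant]
    (μω : HeckeCharacter L) (hμu : μω.IsUnitary)
      (hμω : ∀ x : ideleGroup ↥(maximalRealSubfield L), μω (AdeleRing.ideleBaseChange (↥(maximalRealSubfield L)) L x) = quadraticHeckeCharCM L x)
      (c : ℂ) (hc : c ≠ 0) (hT : ∀ a b, T.Δ a b = c * archExplicitDelta L H' a μω b)
      (hP : (H'.map (cmConjRingHom L)).transpose = H' → (∀ x : Fin 3 → L, hermForm (cmConjRingHom L) H' x x = 0 → x = 0) →
        ∃ w : {w : InfinitePlace L // IsComplex w}, (H'.map w.1.embedding).PosDef ∨ (-H'.map w.1.embedding).PosDef)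
    (hherm : (H'.map (cmConjRingHom L)).transpose = H') (hanis : ∀ x : Fin 3 → L, hermForm (cmConjRingHom L) H' x x = 0 → x = 0),
      letI : ∀ γ : UnitaryGroup.arch (↥(maximalRealSubfield L)) L (IsCMField.complexConj L) 3 H',
          MeasurableSpace (UnitaryGroup.arch (↥(maximalRealSubfield L)) L (IsCMField.complexConj L) 3 H' ⧸
            Subgroup.centralizer ({γ} : Set (UnitaryGroup.arch (↥(maximalRealSubfield L)) L (IsCMField.complexConj L) 3 H'))) :=
        fun _ => borel _
      haveI : ∀ γ : UnitaryGroup.arch (↥(maximalRealSubfield L)) L (IsCMField.complexConj L) 3 H',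
          BorelSpace (UnitaryGroup.arch (↥(maximalRealSubfield L)) L (IsCMField.complexConj L) 3 H' ⧸
            Subgroup.centralizer ({γ} : Set (UnitaryGroup.arch (↥(maximalRealSubfield L)) L (IsCMField.complexConj L) 3 H'))) :=
        fun _ => ⟨rfl⟩
      letI : ∀ γ : UnitaryGroup.arch (↥(maximalRealSubfield L)) L (IsCMField.complexConj L) 3
            (Matrix.of fun i j : Fin 3 => if i.val + j.val + 1 = 3 then (1 : L) else 0),
          MeasurableSpace (UnitaryGroup.arch (↥(maximalRealSubfield L)) L (IsCMField.complexConj L) 3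
              (Matrix.of fun i j : Fin 3 => if i.val + j.val + 1 = 3 then (1 : L) else 0) ⧸
            Subgroup.centralizer ({γ} : Set (UnitaryGroup.arch (↥(maximalRealSubfield L)) L (IsCMField.complexConj L) 3
              (Matrix.of fun i j : Fin 3 => if i.val + j.val + 1 = 3 then (1 : L) else 0)))) :=
        fun _ => borel _
      haveI : ∀ γ : UnitaryGroup.arch (↥(maximalRealSubfield L)) L (IsCMField.complexConj L) 3
            (Matrix.of fun i j : Fin 3 => if i.val + j.val + 1 = 3 then (1 : L) else 0),
          BorelSpace (UnitaryGroup.arch (↥(maximalRealSubfield L)) L (IsCMField.complexConj L) 3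
              (Matrix.of fun i j : Fin 3 => if i.val + j.val + 1 = 3 then (1 : L) else 0) ⧸
            Subgroup.centralizer ({γ} : Set (UnitaryGroup.arch (↥(maximalRealSubfield L)) L (IsCMField.complexConj L) 3
              (Matrix.of fun i j : Fin 3 => if i.val + j.val + 1 = 3 then (1 : L) else 0)))) :=
        fun _ => ⟨rfl⟩
      letI : ∀ a : (UnitaryGroup.arch (↥(maximalRealSubfield L)) L (IsCMField.complexConj L) 2
            (Matrix.of fun i j : Fin 2 => if i.val + j.val + 1 = 2 then (1 : L) else 0) ×
          UnitaryGroup.arch (↥(maximalRealSubfield L)) L (IsCMField.complexConj L) 1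
            (Matrix.of fun i j : Fin 1 => if i.val + j.val + 1 = 1 then (1 : L) else 0)),
          MeasurableSpace ((UnitaryGroup.arch (↥(maximalRealSubfield L)) L (IsCMField.complexConj L) 2
              (Matrix.of fun i j : Fin 2 => if i.val + j.val + 1 = 2 then (1 : L) else 0) ×
            UnitaryGroup.arch (↥(maximalRealSubfield L)) L (IsCMField.complexConj L) 1
              (Matrix.of fun i j : Fin 1 => if i.val + j.val + 1 = 1 then (1 : L) else 0)) ⧸
            Subgroup.centralizer ({a} : Set (UnitaryGroup.arch (↥(maximalRealSubfield L)) L (IsCMField.complexConj L) 2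
              (Matrix.of fun i j : Fin 2 => if i.val + j.val + 1 = 2 then (1 : L) else 0) ×
            UnitaryGroup.arch (↥(maximalRealSubfield L)) L (IsCMField.complexConj L) 1
              (Matrix.of fun i j : Fin 1 => if i.val + j.val + 1 = 1 then (1 : L) else 0)))) :=
        fun _ => borel _
      haveI : ∀ a : (UnitaryGroup.arch (↥(maximalRealSubfield L)) L (IsCMField.complexConj L) 2
            (Matrix.of fun i j : Fin 2 => if i.val + j.val + 1 = 2 then (1 : L) else 0) ×
          UnitaryGroup.arch (↥(maximalRealSubfield L)) L (IsCMField.complexConj L) 1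
            (Matrix.of fun i j : Fin 1 => if i.val + j.val + 1 = 1 then (1 : L) else 0)),
          BorelSpace ((UnitaryGroup.arch (↥(maximalRealSubfield L)) L (IsCMField.complexConj L) 2
              (Matrix.of fun i j : Fin 2 => if i.val + j.val + 1 = 2 then (1 : L) else 0) ×
            UnitaryGroup.arch (↥(maximalRealSubfield L)) L (IsCMField.complexConj L) 1
              (Matrix.of fun i j : Fin 1 => if i.val + j.val + 1 = 1 then (1 : L) else 0)) ⧸
            Subgroup.centralizer ({a} : Set (UnitaryGroup.arch (↥(maximalRealSubfield L)) L (IsCMField.complexConj L) 2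
              (Matrix.of fun i j : Fin 2 => if i.val + j.val + 1 = 2 then (1 : L) else 0) ×
            UnitaryGroup.arch (↥(maximalRealSubfield L)) L (IsCMField.complexConj L) 1
              (Matrix.of fun i j : Fin 1 => if i.val + j.val + 1 = 1 then (1 : L) else 0)))) :=
        fun _ => ⟨rfl⟩
      ∀ (m' : OrbitalMeasureFamily (UnitaryGroup.arch (↥(maximalRealSubfield L)) L (IsCMField.complexConj L) 3 H'))
        (m : OrbitalMeasureFamily (UnitaryGroup.arch (↥(maximalRealSubfield L)) L (IsCMField.complexConj L) 3
          (Matrix.of fun i j : Fin 3 => if i.val + j.val + 1 = 3 then (1 : L) else 0)))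
        (mH : OrbitalMeasureFamily (UnitaryGroup.arch (↥(maximalRealSubfield L)) L (IsCMField.complexConj L) 2
            (Matrix.of fun i j : Fin 2 => if i.val + j.val + 1 = 2 then (1 : L) else 0) ×
          UnitaryGroup.arch (↥(maximalRealSubfield L)) L (IsCMField.complexConj L) 1
            (Matrix.of fun i j : Fin 1 => if i.val + j.val + 1 = 1 then (1 : L) else 0)))
        (t' : ∀ γ' : UnitaryGroup.arch (↥(maximalRealSubfield L)) L (IsCMField.complexConj L) 3 H',
          Measure (Subgroup.centralizer ({γ'} : Set (UnitaryGroup.arch (↥(maximalRealSubfield L)) L (IsCMField.complexConj L) 3 H'))))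
        (t : ∀ γ : UnitaryGroup.arch (↥(maximalRealSubfield L)) L (IsCMField.complexConj L) 3
            (Matrix.of fun i j : Fin 3 => if i.val + j.val + 1 = 3 then (1 : L) else 0),
          Measure (Subgroup.centralizer ({γ} : Set (UnitaryGroup.arch (↥(maximalRealSubfield L)) L (IsCMField.complexConj L) 3
            (Matrix.of fun i j : Fin 3 => if i.val + j.val + 1 = 3 then (1 : L) else 0)))))
        (tH : ∀ γH : UnitaryGroup.arch (↥(maximalRealSubfield L)) L (IsCMField.complexConj L) 2
              (Matrix.of fun i j : Fin 2 => if i.val + j.val + 1 = 2 then (1 : L) else 0) ×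
            UnitaryGroup.arch (↥(maximalRealSubfield L)) L (IsCMField.complexConj L) 1
              (Matrix.of fun i j : Fin 1 => if i.val + j.val + 1 = 1 then (1 : L) else 0),
          Measure (Subgroup.centralizer ({γH} : Set (UnitaryGroup.arch (↥(maximalRealSubfield L)) L (IsCMField.complexConj L) 2
              (Matrix.of fun i j : Fin 2 => if i.val + j.val + 1 = 2 then (1 : L) else 0) ×
            UnitaryGroup.arch (↥(maximalRealSubfield L)) L (IsCMField.complexConj L) 1
              (Matrix.of fun i j : Fin 1 => if i.val + j.val + 1 = 1 then (1 : L) else 0))))),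
      (
        m'.IsAdmissibleOn (fun γ => IsRegularElt (γ.val : GL (Fin 3) (mixedEmbedding.mixedSpace L))) ∧
          m.IsAdmissibleOn (fun γ => IsRegularElt (γ.val : GL (Fin 3) (mixedEmbedding.mixedSpace L))) ∧
          mH.IsAdmissibleOn (IsArchGRegular L) ∧
          IsArchNondegenerate L H' T ∧
          IsArchInnerTransferExists L H' m' m (ArchSmooth L 3 H')
            (ArchSmooth L 3 (Matrix.of fun i j : Fin 3 => if i.val + j.val + 1 = 3 then (1 : L) else 0)) ∧
          IsArchDeltaTransferExists L H' T mH m' (ArchSmooth L 3 H') (ArchSmooth₂ L) ∧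
        m'.IsQuotientOf (fun γ => IsRegularElt (γ.val : GL (Fin 3) (mixedEmbedding.mixedSpace L))) ν' t' ∧
          m.IsQuotientOf (fun γ => IsRegularElt (γ.val : GL (Fin 3) (mixedEmbedding.mixedSpace L))) ν t ∧
          mH.IsQuotientOf (IsArchGRegular L) νH tH ∧
        (∀ (γ₁ γ₂ : UnitaryGroup.arch (↥(maximalRealSubfield L)) L (IsCMField.complexConj L) 3 H')
            (h₁ : IsRegularElt (γ₁.val : GL (Fin 3) (mixedEmbedding.mixedSpace L)))
            (hc : Corresponds (UnitaryGroup.conjMixed (↥(maximalRealSubfield L)) L (IsCMField.complexConj L))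
              (UnitaryGroup.archFormOf L 3 H') (UnitaryGroup.archFormOf L 3 H') γ₁ γ₂),
            Measure.map ⇑(UnitaryGroup.archStableCentralizerEquiv L (Godement.det_ne_zero_of_anisotropic L H' hanis)
              (Godement.det_ne_zero_of_anisotropic L H' hanis) hc h₁) (t' γ₁) = t' γ₂) ∧
        (∀ (γ₁ γ₂ : UnitaryGroup.arch (↥(maximalRealSubfield L)) L (IsCMField.complexConj L) 3
              (Matrix.of fun i j : Fin 3 => if i.val + j.val + 1 = 3 then (1 : L) else 0))
            (h₁ : IsRegularElt (γ₁.val : GL (Fin 3) (mixedEmbedding.mixedSpace L)))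
            (hc : Corresponds (UnitaryGroup.conjMixed (↥(maximalRealSubfield L)) L (IsCMField.complexConj L))
              (UnitaryGroup.archFormOf L 3 (Matrix.of fun i j : Fin 3 => if i.val + j.val + 1 = 3 then (1 : L) else 0))
              (UnitaryGroup.archFormOf L 3 (Matrix.of fun i j : Fin 3 => if i.val + j.val + 1 = 3 then (1 : L) else 0)) γ₁ γ₂),
            Measure.map ⇑(UnitaryGroup.archStableCentralizerEquiv L (UnitaryGroup.isUnit_antidiagOne_det L 3).ne_zero
              (UnitaryGroup.isUnit_antidiagOne_det L 3).ne_zero hc h₁) (t γ₁) = t γ₂) ∧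
        (∀ (γ' : UnitaryGroup.arch (↥(maximalRealSubfield L)) L (IsCMField.complexConj L) 3 H')
            (γ : UnitaryGroup.arch (↥(maximalRealSubfield L)) L (IsCMField.complexConj L) 3
              (Matrix.of fun i j : Fin 3 => if i.val + j.val + 1 = 3 then (1 : L) else 0))
            (h' : IsRegularElt (γ'.val : GL (Fin 3) (mixedEmbedding.mixedSpace L)))
            (hc : Corresponds (UnitaryGroup.conjMixed (↥(maximalRealSubfield L)) L (IsCMField.complexConj L))
              (UnitaryGroup.archFormOf L 3 H')
              (UnitaryGroup.archFormOf L 3 (Matrix.of fun i j : Fin 3 => if i.val + j.val + 1 = 3 then (1 : L) else 0)) γ' γ),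
            Measure.map ⇑(UnitaryGroup.archStableCentralizerEquiv L (Godement.det_ne_zero_of_anisotropic L H' hanis)
              (UnitaryGroup.isUnit_antidiagOne_det L 3).ne_zero hc h') (t' γ') = t γ) ∧
        (∀ γH : UnitaryGroup.arch (↥(maximalRealSubfield L)) L (IsCMField.complexConj L) 2
              (Matrix.of fun i j : Fin 2 => if i.val + j.val + 1 = 2 then (1 : L) else 0) ×
            UnitaryGroup.arch (↥(maximalRealSubfield L)) L (IsCMField.complexConj L) 1
              (Matrix.of fun i j : Fin 1 => if i.val + j.val + 1 = 1 then (1 : L) else 0),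
            IsArchGRegular L γH → Measure.map ⇑(endoEmbArchCentralizer L γH) (tH γH) = t (endoEmbArch L γH))
      ) →
        ∀ (aH : (UnitaryGroup.arch (↥(maximalRealSubfield L)) L (IsCMField.complexConj L) 2 (Matrix.of fun i j : Fin 2 => if i.val + j.val + 1 = 2 then (1 : L) else 0) ×
          UnitaryGroup.arch (↥(maximalRealSubfield L)) L (IsCMField.complexConj L) 1 (Matrix.of fun i j : Fin 1 => if i.val + j.val + 1 = 1 then (1 : L) else 0)) → ℂ)
            (a' : UnitaryGroup.arch (↥(maximalRealSubfield L)) L (IsCMField.complexConj L) 3 H' → ℂ),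
            ArchSmooth₂ L aH → ArchSmooth L 3 H' a' → IsArchDeltaTransfer L H' T mH m' aH a' →
            ∀ (γH : (UnitaryGroup.cmDatum L 2 (Matrix.of fun i j : Fin 2 => if i.val + j.val + 1 = 2 then (1 : L) else 0)).Rational ×
                (UnitaryGroup.cmDatum L 1 (Matrix.of fun i j : Fin 1 => if i.val + j.val + 1 = 1 then (1 : L) else 0)).Rational) (ζ : L),
              (((γH.1 : unitaryGroup (cmConjRingHom L) (Matrix.of fun i j : Fin 2 => if i.val + j.val + 1 = 2 then (1 : L) else 0)).val : GL (Fin 2) L) :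
                  Matrix (Fin 2) (Fin 2) L) = ζ • (1 : Matrix (Fin 2) (Fin 2) L) →
              (((γH.2 : unitaryGroup (cmConjRingHom L) (Matrix.of fun i j : Fin 1 => if i.val + j.val + 1 = 1 then (1 : L) else 0)).val : GL (Fin 1) L) :
                  Matrix (Fin 1) (Fin 1) L) = ζ • (1 : Matrix (Fin 1) (Fin 1) L) →
              aH (cmRationalToArch L 2 (Matrix.of fun i j : Fin 2 => if i.val + j.val + 1 = 2 then (1 : L) else 0) γH.1,
                  cmRationalToArch L 1 (Matrix.of fun i j : Fin 1 => if i.val + j.val + 1 = 1 then (1 : L) else 0) γH.2) = 0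
    := by
  intro L _ _ _ H' T _ _ _ _ _ _ ν' ν νH _ _ _ _ _ _ μω hμu hμω c hc hT hP hherm hanis
  -- the orbit σ-algebras of the statement (inlined there by `letI`), re-declared as local instances
  letI iQ' : ∀ γ : UnitaryGroup.arch (↥(maximalRealSubfield L)) L (IsCMField.complexConj L) 3 H',
      MeasurableSpace (UnitaryGroup.arch (↥(maximalRealSubfield L)) L (IsCMField.complexConj L) 3 H' ⧸
        Subgroup.centralizer ({γ} : Set (UnitaryGroup.arch (↥(maximalRealSubfield L)) L (IsCMField.complexConj L) 3 H'))) :=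
    fun _ => borel _
  haveI iB' : ∀ γ : UnitaryGroup.arch (↥(maximalRealSubfield L)) L (IsCMField.complexConj L) 3 H',
      BorelSpace (UnitaryGroup.arch (↥(maximalRealSubfield L)) L (IsCMField.complexConj L) 3 H' ⧸
        Subgroup.centralizer ({γ} : Set (UnitaryGroup.arch (↥(maximalRealSubfield L)) L (IsCMField.complexConj L) 3 H'))) :=
    fun _ => ⟨rfl⟩
  letI iQ : ∀ γ : UnitaryGroup.arch (↥(maximalRealSubfield L)) L (IsCMField.complexConj L) 3
        (Matrix.of fun i j : Fin 3 => if i.val + j.val + 1 = 3 then (1 : L) else 0),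
      MeasurableSpace (UnitaryGroup.arch (↥(maximalRealSubfield L)) L (IsCMField.complexConj L) 3
          (Matrix.of fun i j : Fin 3 => if i.val + j.val + 1 = 3 then (1 : L) else 0) ⧸
        Subgroup.centralizer ({γ} : Set (UnitaryGroup.arch (↥(maximalRealSubfield L)) L (IsCMField.complexConj L) 3
          (Matrix.of fun i j : Fin 3 => if i.val + j.val + 1 = 3 then (1 : L) else 0)))) :=
    fun _ => borel _
  haveI iB : ∀ γ : UnitaryGroup.arch (↥(maximalRealSubfield L)) L (IsCMField.complexConj L) 3
        (Matrix.of fun i j : Fin 3 => if i.val + j.val + 1 = 3 then (1 : L) else 0),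
      BorelSpace (UnitaryGroup.arch (↥(maximalRealSubfield L)) L (IsCMField.complexConj L) 3
          (Matrix.of fun i j : Fin 3 => if i.val + j.val + 1 = 3 then (1 : L) else 0) ⧸
        Subgroup.centralizer ({γ} : Set (UnitaryGroup.arch (↥(maximalRealSubfield L)) L (IsCMField.complexConj L) 3
          (Matrix.of fun i j : Fin 3 => if i.val + j.val + 1 = 3 then (1 : L) else 0)))) :=
    fun _ => ⟨rfl⟩
  letI iQH : ∀ a : (UnitaryGroup.arch (↥(maximalRealSubfield L)) L (IsCMField.complexConj L) 2
        (Matrix.of fun i j : Fin 2 => if i.val + j.val + 1 = 2 then (1 : L) else 0) ×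
      UnitaryGroup.arch (↥(maximalRealSubfield L)) L (IsCMField.complexConj L) 1
        (Matrix.of fun i j : Fin 1 => if i.val + j.val + 1 = 1 then (1 : L) else 0)),
      MeasurableSpace ((UnitaryGroup.arch (↥(maximalRealSubfield L)) L (IsCMField.complexConj L) 2
          (Matrix.of fun i j : Fin 2 => if i.val + j.val + 1 = 2 then (1 : L) else 0) ×
        UnitaryGroup.arch (↥(maximalRealSubfield L)) L (IsCMField.complexConj L) 1
          (Matrix.of fun i j : Fin 1 => if i.val + j.val + 1 = 1 then (1 : L) else 0)) ⧸
        Subgroup.centralizer ({a} : Set (UnitaryGroup.arch (↥(maximalRealSubfield L)) L (IsCMField.complexConj L) 2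
          (Matrix.of fun i j : Fin 2 => if i.val + j.val + 1 = 2 then (1 : L) else 0) ×
        UnitaryGroup.arch (↥(maximalRealSubfield L)) L (IsCMField.complexConj L) 1
          (Matrix.of fun i j : Fin 1 => if i.val + j.val + 1 = 1 then (1 : L) else 0)))) :=
    fun _ => borel _
  haveI iBH : ∀ a : (UnitaryGroup.arch (↥(maximalRealSubfield L)) L (IsCMField.complexConj L) 2
        (Matrix.of fun i j : Fin 2 => if i.val + j.val + 1 = 2 then (1 : L) else 0) ×
      UnitaryGroup.arch (↥(maximalRealSubfield L)) L (IsCMField.complexConj L) 1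
        (Matrix.of fun i j : Fin 1 => if i.val + j.val + 1 = 1 then (1 : L) else 0)),
      BorelSpace ((UnitaryGroup.arch (↥(maximalRealSubfield L)) L (IsCMField.complexConj L) 2
          (Matrix.of fun i j : Fin 2 => if i.val + j.val + 1 = 2 then (1 : L) else 0) ×
        UnitaryGroup.arch (↥(maximalRealSubfield L)) L (IsCMField.complexConj L) 1
          (Matrix.of fun i j : Fin 1 => if i.val + j.val + 1 = 1 then (1 : L) else 0)) ⧸
        Subgroup.centralizer ({a} : Set (UnitaryGroup.arch (↥(maximalRealSubfield L)) L (IsCMField.complexConj L) 2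
          (Matrix.of fun i j : Fin 2 => if i.val + j.val + 1 = 2 then (1 : L) else 0) ×
        UnitaryGroup.arch (↥(maximalRealSubfield L)) L (IsCMField.complexConj L) 1
          (Matrix.of fun i j : Fin 1 => if i.val + j.val + 1 = 1 then (1 : L) else 0)))) :=
    fun _ => ⟨rfl⟩
  intro m' m mH t' t tH hsys aH a' haH ha' hδ γH ζ hζ₂ hζ₁
  obtain ⟨-, -, -, -, -, -, hW', -, hWH, -, hC, hC'G, hCH⟩ := hsys
  -- measurability of the two test functions
  have haHm : Measurable aH := haH.continuous.measurable
  have ha'm : Measurable a' := ha'.continuous.measurable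
  -- the central angles `σ_w ζ ∈ S¹`
  have hζn : ∀ w : {w : InfinitePlace L // IsComplex w}, ‖w.1.embedding ζ‖ = 1 := norm_embedding_eq_one_of_coe_eq_smul_one γH.2 hζ₁
  /- STEP 1: the rational diagonal frame of `H′` and its guards -/
  obtain ⟨P, α', hPα⟩ := exists_formCongr_eq_diagonal L H' hherm hanis
  have hherm' : ((Matrix.diagonal α').map (cmConjRingHom L))ᵀ = Matrix.diagonal α' := by
    have h := UnitaryGroup.transpose_map_formCongr_cm L P hherm
    rwa [hPα] at h
  have hanis' : ∀ x : Fin 3 → L, hermForm (cmConjRingHom L) (Matrix.diagonal α') x x = 0 → x = 0 := by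
    have h := UnitaryGroup.anisotropic_formCongr_cm L P hanis
    rwa [hPα] at h
  obtain ⟨w₀, hw₀⟩ : ∃ w : {w : InfinitePlace L // IsComplex w},
      ((Matrix.diagonal α').map (w.1.embedding : L →+* ℂ)).PosDef ∨ (-((Matrix.diagonal α').map (w.1.embedding : L →+* ℂ))).PosDef := by
    have h := UnitaryGroup.exists_posDef_formCongr_cm L P (hP hherm hanis)
    rwa [hPα] at h
  have hα' : ∀ i, α' i ≠ 0 := by
    have hdet := Godement.det_ne_zero_of_anisotropic L (Matrix.diagonal α') hanis'
    rw [Matrix.det_diagonal] at hdet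
    exact fun i => (Finset.prod_ne_zero_iff.1 hdet) i (Finset.mem_univ i)
  have hαherm : ∀ i, (IsCMField.complexConj L (α' i) : L) = α' i := by
    intro i
    have h := congrFun (congrFun hherm' i) i
    rw [Matrix.transpose_apply, Matrix.map_apply, Matrix.diagonal_apply_eq] at h
    exact h
  have hreal : ∀ (w : {w : InfinitePlace L // IsComplex w}) (i : Fin 3), (w.1.embedding (α' i)).im = 0 :=
    fun w i => UnitaryGroup.im_embedding_eq_zero_of_complexConj_eq L w (hαherm i)
  -- the congruence `Φ_P : U(diagonal α′)_∞ ≃ₜ* U(H′)_∞`, abstracted with its two properties (action; ★ (3T-b) congruence covariance of `Δ″_∞`)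
  obtain ⟨Φ, hΦ, hΦΔ⟩ : ∃ Φ : UnitaryGroup.arch (↥(maximalRealSubfield L)) L (IsCMField.complexConj L) 3 (Matrix.diagonal α') ≃ₜ*
        UnitaryGroup.arch (↥(maximalRealSubfield L)) L (IsCMField.complexConj L) 3 H',
      (∀ g, ((Φ g : UnitaryGroup.arch (↥(maximalRealSubfield L)) L (IsCMField.complexConj L) 3 H') : GL (Fin 3) (mixedSpace L)) =
          Matrix.GeneralLinearGroup.map (mixedEmbedding L) P * (g : GL (Fin 3) (mixedSpace L)) * (Matrix.GeneralLinearGroup.map (mixedEmbedding L) P)⁻¹) ∧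
      ∀ (a : UnitaryGroup.arch (↥(maximalRealSubfield L)) L (IsCMField.complexConj L) 2 (Matrix.of fun i j : Fin 2 => if i.val + j.val + 1 = 2 then (1 : L) else 0) ×
          UnitaryGroup.arch (↥(maximalRealSubfield L)) L (IsCMField.complexConj L) 1 (Matrix.of fun i j : Fin 1 => if i.val + j.val + 1 = 1 then (1 : L) else 0)) g,
        archExplicitDelta L H' a μω (Φ g) = archExplicitDelta L (Matrix.diagonal α') a μω g :=
    ⟨_, UnitaryGroup.coe_archCongrOfEq_apply L hPα, fun a g => archExplicitDelta_archCongrOfEq L hPα a μω g⟩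
  letI iD : MeasurableSpace (UnitaryGroup.arch (↥(maximalRealSubfield L)) L (IsCMField.complexConj L) 3 (Matrix.diagonal α')) := borel _
  haveI iDB : BorelSpace (UnitaryGroup.arch (↥(maximalRealSubfield L)) L (IsCMField.complexConj L) 3 (Matrix.diagonal α')) := ⟨rfl⟩
  haveI : (ν'.map Φ.symm).IsHaarMeasure := ContinuousMulEquiv.isHaarMeasure_map ν' Φ.symm
  haveI : (ν'.map Φ.symm).IsMulRightInvariant := isMulRightInvariant_map_mulEquiv_of_isMulRightInvariant Φ.symm.toMulEquiv Φ.symm.continuous.measurable ν'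
  have ha'Φ : ArchSmooth L 3 (Matrix.diagonal α') (a' ∘ Φ) := ha'.comp_archCongr L _ Φ hΦ
  have hTΦ : ∀ a b, (T.comap Φ.toMulEquiv (isArchNormPair_of_archCongr L _ Φ hΦ) : ArchTransferFactor L (Matrix.diagonal α')).Δ a b =
      c * archExplicitDelta L (Matrix.diagonal α') a μω b := fun a b =>
    calc (T.comap Φ.toMulEquiv (isArchNormPair_of_archCongr L _ Φ hΦ) : ArchTransferFactor L (Matrix.diagonal α')).Δ a b = T.Δ a (Φ b) := rfl
      _ = c * archExplicitDelta L H' a μω (Φ b) := hT a (Φ b)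
      _ = c * archExplicitDelta L (Matrix.diagonal α') a μω b := by rw [hΦΔ]
  /- STEP 2: the 2-block frame `U(diag(½,−½))`, its Haar data, and the 2-block test function `Θ₂` -/
  letI iw : ∀ w : {w : InfinitePlace L // IsComplex w}, MeasurableSpace (UnitaryGroup.archLocal L 2 (Matrix.diagonal ![(2 : L)⁻¹, -(2 : L)⁻¹]) w) := fun _ => borel _
  haveI iwB : ∀ w : {w : InfinitePlace L // IsComplex w}, BorelSpace (UnitaryGroup.archLocal L 2 (Matrix.diagonal ![(2 : L)⁻¹, -(2 : L)⁻¹]) w) := fun _ => ⟨rfl⟩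
  haveI : ∀ w : {w : InfinitePlace L // IsComplex w}, LocallyCompactSpace (UnitaryGroup.archLocal L 2 (Matrix.diagonal ![(2 : L)⁻¹, -(2 : L)⁻¹]) w) :=
    fun w => UnitaryGroup.locallyCompactSpace_archLocal L 2 _ w
  let νw : ∀ w : {w : InfinitePlace L // IsComplex w}, Measure (UnitaryGroup.archLocal L 2 (Matrix.diagonal ![(2 : L)⁻¹, -(2 : L)⁻¹]) w) := fun _ => Measure.haar
  haveI : ∀ w, (νw w).IsHaarMeasure := fun _ => inferInstance
  -- the endoscopic congruence `Ψ = Φ_{Q₂} : U(Φ₂)_∞ ≃ₜ* U(diag(½,−½))_∞` of ★ (R3-a)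
  set Ψ : UnitaryGroup.arch (↥(maximalRealSubfield L)) L (IsCMField.complexConj L) 2 (Matrix.of fun i j : Fin 2 => if i.val + j.val + 1 = 2 then (1 : L) else 0) ≃ₜ*
      UnitaryGroup.arch (↥(maximalRealSubfield L)) L (IsCMField.complexConj L) 2 (Matrix.diagonal ![(2 : L)⁻¹, -(2 : L)⁻¹]) :=
    unitaryGroupOfFormCongrOfEq (UnitaryGroup.conjMixed (↥(maximalRealSubfield L)) L (IsCMField.complexConj L))
      (Matrix.GeneralLinearGroup.map (mixedEmbedding L) (Matrix.GeneralLinearGroup.mkOfDetNeZero !![(1 : L), 1; 1, -1] (UnitaryGroup.det_quasiSplitFrameTwo_ne_zero L)))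
      (UnitaryGroup.archFormOf L 2 (Matrix.diagonal ![(2 : L)⁻¹, -(2 : L)⁻¹])) (UnitaryGroup.archFormOf L 2 (Matrix.of fun i j : Fin 2 => if i.val + j.val + 1 = 2 then (1 : L) else 0))
      (UnitaryGroup.formCongr_map_mixedEmbedding_archFormOf_eq L (UnitaryGroup.formCongr_quasiSplitFrameTwo_diagonal L)) with hΨdef
  have hΨ : ∀ x, ((Ψ x : UnitaryGroup.arch (↥(maximalRealSubfield L)) L (IsCMField.complexConj L) 2 (Matrix.diagonal ![(2 : L)⁻¹, -(2 : L)⁻¹])) : GL (Fin 2) (mixedSpace L)) =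
      Matrix.GeneralLinearGroup.map (mixedEmbedding L) (Matrix.GeneralLinearGroup.mkOfDetNeZero !![(1 : L), 1; 1, -1] (UnitaryGroup.det_quasiSplitFrameTwo_ne_zero L)) *
        (x : GL (Fin 2) (mixedSpace L)) * (Matrix.GeneralLinearGroup.map (mixedEmbedding L) (Matrix.GeneralLinearGroup.mkOfDetNeZero !![(1 : L), 1; 1, -1] (UnitaryGroup.det_quasiSplitFrameTwo_ne_zero L)))⁻¹ :=
    fun x => UnitaryGroup.coe_archCongrOfEq_apply L (UnitaryGroup.formCongr_quasiSplitFrameTwo_diagonal L) x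
  -- ★ (3A′): the 2-block test function with the `U(Φ₁)`-coordinate frozen at `δ = e₁⁻¹ (w ↦ diag(σ_w ζ))`
  obtain ⟨Θ₂, hΘ, hΘc, hΘa⟩ := haH.exists_contDiff_twoBlock
    (Matrix.GeneralLinearGroup.map (mixedEmbedding L) (Matrix.GeneralLinearGroup.mkOfDetNeZero !![(1 : L), 1; 1, -1] (UnitaryGroup.det_quasiSplitFrameTwo_ne_zero L))) Ψ hΨ
    ((UnitaryGroup.archPiEquivCM 1 L (Matrix.of fun i j : Fin 1 => if i.val + j.val + 1 = 1 then (1 : L) else 0)).symm fun w =>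
      ⟨UnitaryGroup.circleDiagonal 1 ![(⟨w.1.embedding ζ, mem_sphere_zero_iff_norm.mpr (hζn w)⟩ : Circle)], UnitaryGroup.circleDiagonal_mem_archLocal_antidiagOne L w _⟩)
  -- the centre `γ_H ⊗ 1` in the 2-block frame (★ (3A′) §3)
  have hcen₂ : cmRationalToArch L 1 (Matrix.of fun i j : Fin 1 => if i.val + j.val + 1 = 1 then (1 : L) else 0) γH.2 =
      (UnitaryGroup.archPiEquivCM 1 L (Matrix.of fun i j : Fin 1 => if i.val + j.val + 1 = 1 then (1 : L) else 0)).symm fun w =>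
        ⟨UnitaryGroup.circleDiagonal 1 ![(⟨w.1.embedding ζ, mem_sphere_zero_iff_norm.mpr (hζn w)⟩ : Circle)], UnitaryGroup.circleDiagonal_mem_archLocal_antidiagOne L w _⟩ :=
    cmRationalToArch_one_eq_symm_circleDiagonal_of_coe_eq_smul_one γH.2 hζ₁
  have hcen₁ : Ψ (cmRationalToArch L 2 (Matrix.of fun i j : Fin 2 => if i.val + j.val + 1 = 2 then (1 : L) else 0) γH.1) =
      UnitaryGroup.archDiagTorus L 2 ![(2 : L)⁻¹, -(2 : L)⁻¹] (fun w _ => (⟨w.1.embedding ζ, mem_sphere_zero_iff_norm.mpr (hζn w)⟩ : Circle)) :=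
    congr_cmRationalToArch_two_eq_archDiagTorus_of_coe_eq_smul_one
      (Matrix.GeneralLinearGroup.map (mixedEmbedding L) (Matrix.GeneralLinearGroup.mkOfDetNeZero !![(1 : L), 1; 1, -1] (UnitaryGroup.det_quasiSplitFrameTwo_ne_zero L))) Ψ hΨ γH.1 hζ₂ hζn
  -- the claim is `Θ₂(centre) = 0`
  have hval : aH (cmRationalToArch L 2 (Matrix.of fun i j : Fin 2 => if i.val + j.val + 1 = 2 then (1 : L) else 0) γH.1,
      cmRationalToArch L 1 (Matrix.of fun i j : Fin 1 => if i.val + j.val + 1 = 1 then (1 : L) else 0) γH.2) =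
      Θ₂ ((((UnitaryGroup.archPiEquivCM 2 L (Matrix.diagonal ![(2 : L)⁻¹, -(2 : L)⁻¹])).symm (fun w : {w : InfinitePlace L // IsComplex w} =>
        (⟨UnitaryGroup.circleDiagonal 2 ![(⟨w.1.embedding ζ, mem_sphere_zero_iff_norm.mpr (hζn w)⟩ : Circle), (⟨w.1.embedding ζ, mem_sphere_zero_iff_norm.mpr (hζn w)⟩ : Circle)],
          UnitaryGroup.circleDiagonal_mem_archLocal_diagonal L 2 ![(2 : L)⁻¹, -(2 : L)⁻¹] w _⟩ : UnitaryGroup.archLocal L 2 (Matrix.diagonal ![(2 : L)⁻¹, -(2 : L)⁻¹]) w)) :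
          UnitaryGroup.arch (↥(maximalRealSubfield L)) L (IsCMField.complexConj L) 2 (Matrix.diagonal ![(2 : L)⁻¹, -(2 : L)⁻¹])) : GL (Fin 2) (mixedSpace L)) : Matrix (Fin 2) (Fin 2) (mixedSpace L)) := by
    rw [hΘa, hcen₂]
    congr 2
    apply Ψ.injective
    rw [ContinuousMulEquiv.apply_symm_apply, hcen₁, UnitaryGroup.archDiagTorus_eq_symm_apply]
    congr 1
    funext w
    apply Subtype.ext
    show UnitaryGroup.circleDiagonal 2 _ = UnitaryGroup.circleDiagonal 2 _
    congr 1
    funext i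
    fin_cases i <;> rfl
  rw [hval]
  /- STEP 3: the descent ★ (3D) at `S₀ = univ ∖ w₀`, fed by ★ (E2) §2 along the central curve at `w₀`, ★ (β) and ★ (3G♭) -/
  refine UnitaryGroup.apply_center_eq_zero_of_forall_sum_integral_pi_eq_zero_of_ne_center L (![(2 : L)⁻¹, -(2 : L)⁻¹]) νw
    (fun w : {w : InfinitePlace L // IsComplex w} => (⟨w.1.embedding ζ, mem_sphere_zero_iff_norm.mpr (hζn w)⟩ : Circle)) (UnitaryGroup.quasiSplitWeightsTwo_ne_zero (L := L)) Θ₂ hΘ hΘc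
    (fun w => UnitaryGroup.im_embedding_quasiSplitWeightsTwo_eq_zero L w) (UnitaryGroup.re_embedding_quasiSplitWeightsTwo_mul_neg L) (Finset.univ.erase w₀) ?_
  intro u hu
  -- B-p12's curve data for this `u`: base point `z₀ = (u₀, σζ, u₁)` off `w₀`, `(σζ, σζ, σζ)` at `w₀`; speed `1` at `w₀`, `0` elsewhere
  -- (the curve data are introduced as opaque names with defining equations: no `set`-abstraction over the large context)
  obtain ⟨z₀, hz₀⟩ : ∃ z₀ : {w : InfinitePlace L // IsComplex w} → Fin 3 → Circle, z₀ = fun w =>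
      if w = w₀ then ![(⟨w.1.embedding ζ, mem_sphere_zero_iff_norm.mpr (hζn w)⟩ : Circle), (⟨w.1.embedding ζ, mem_sphere_zero_iff_norm.mpr (hζn w)⟩ : Circle),
          (⟨w.1.embedding ζ, mem_sphere_zero_iff_norm.mpr (hζn w)⟩ : Circle)]
        else ![u w 0, (⟨w.1.embedding ζ, mem_sphere_zero_iff_norm.mpr (hζn w)⟩ : Circle), u w 1] := ⟨_, rfl⟩
  obtain ⟨c₁, hc₁⟩ : ∃ c₁ : {w : InfinitePlace L // IsComplex w} → ℝ, c₁ = fun w => if w = w₀ then 1 else 0 := ⟨_, rfl⟩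
  have hc1 : c₁ w₀ = 1 := by
    rw [hc₁]
    exact if_pos rfl
  have hc₀ : c₁ w₀ ≠ 0 := by
    rw [hc1]
    exact one_ne_zero
  have hc₁' : ∀ w, w ≠ w₀ → c₁ w = 0 := fun w hw => by
    rw [hc₁]
    exact if_neg hw
  have hz₀w₀ : z₀ w₀ = ![(⟨w₀.1.embedding ζ, mem_sphere_zero_iff_norm.mpr (hζn w₀)⟩ : Circle), (⟨w₀.1.embedding ζ, mem_sphere_zero_iff_norm.mpr (hζn w₀)⟩ : Circle),
      (⟨w₀.1.embedding ζ, mem_sphere_zero_iff_norm.mpr (hζn w₀)⟩ : Circle)] := by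
    rw [hz₀]
    exact if_pos rfl
  have hz₀w : ∀ w, w ≠ w₀ → z₀ w = ![u w 0, (⟨w.1.embedding ζ, mem_sphere_zero_iff_norm.mpr (hζn w)⟩ : Circle), u w 1] := fun w hw => by
    rw [hz₀]
    exact if_neg hw
  have hcen : z₀ w₀ 0 = z₀ w₀ 1 ∧ z₀ w₀ 2 = z₀ w₀ 1 := by
    rw [hz₀w₀]
    exact ⟨rfl, rfl⟩
  have hinj : ∀ w, w ≠ w₀ → Function.Injective (z₀ w) := by
    intro w hw
    obtain ⟨h01, h0z, h1z⟩ := hu w (Finset.mem_erase.2 ⟨hw, Finset.mem_univ w⟩)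
    rw [hz₀w w hw]
    exact injective_of_pairwise_ne_three h0z h01 (fun h => h1z h.symm)
  -- the curve (the lambdas of ★ `ArchSingularCurveNormPair`)
  obtain ⟨γHc, hγHc⟩ : ∃ γHc : ℝ → (UnitaryGroup.arch (↥(maximalRealSubfield L)) L (IsCMField.complexConj L) 2 (Matrix.of fun i j : Fin 2 => if i.val + j.val + 1 = 2 then (1 : L) else 0) ×
      UnitaryGroup.arch (↥(maximalRealSubfield L)) L (IsCMField.complexConj L) 1 (Matrix.of fun i j : Fin 1 => if i.val + j.val + 1 = 1 then (1 : L) else 0)), γHc = fun ψ =>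
    ((UnitaryGroup.archPiEquivCM 2 L (Matrix.of fun i j : Fin 2 => if i.val + j.val + 1 = 2 then (1 : L) else 0)).symm fun w =>
        ⟨Matrix.GeneralLinearGroup.mkOfDetNeZero !![(1 : ℂ), 1; 1, -1] UnitaryGroup.det_cayleyTwo_ne_zero *
            UnitaryGroup.circleDiagonal 2 ![z₀ w 0 * Circle.exp (![(1 : ℝ), 0, -1] 0 * (c₁ w * ψ)), z₀ w 2 * Circle.exp (![(1 : ℝ), 0, -1] 2 * (c₁ w * ψ))] *
          (Matrix.GeneralLinearGroup.mkOfDetNeZero !![(1 : ℂ), 1; 1, -1] UnitaryGroup.det_cayleyTwo_ne_zero)⁻¹,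
          UnitaryGroup.cayley_conj_circleDiagonal_mem_archLocal L w _⟩,
      (UnitaryGroup.archPiEquivCM 1 L (Matrix.of fun i j : Fin 1 => if i.val + j.val + 1 = 1 then (1 : L) else 0)).symm fun w =>
        ⟨UnitaryGroup.circleDiagonal 1 ![z₀ w 1 * Circle.exp (![(1 : ℝ), 0, -1] 1 * (c₁ w * ψ))],
          UnitaryGroup.circleDiagonal_mem_archLocal_antidiagOne L w _⟩) := ⟨_, rfl⟩
  obtain ⟨γGc, hγGc⟩ : ∃ γGc : ℝ → UnitaryGroup.arch (↥(maximalRealSubfield L)) L (IsCMField.complexConj L) 3 (Matrix.diagonal α'),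
      γGc = fun ψ => UnitaryGroup.archDiagTorus L 3 α' fun w i => z₀ w i * Circle.exp (![(1 : ℝ), 0, -1] i * (c₁ w * ψ)) := ⟨_, rfl⟩
  -- ★ (β): the torus identity along the curve (ONE `κ`)
  obtain ⟨κ, hκ, hβ⟩ := sum_integral_pi_eq_inv_mul_finsum_delta_comap_archSingularCurve L H' tH t' t (Godement.det_ne_zero_of_anisotropic L H' hanis)
    (UnitaryGroup.isUnit_antidiagOne_det L 3).ne_zero hC hC'G hCH α' (Matrix.GeneralLinearGroup.map (mixedEmbedding L) P) Φ hΦ νw z₀ c₁ γHc γGc hγHc hγGc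
    T ν' νH mH m' hWH hW' aH a' haHm ha'm hδ hα' hαherm (fun w : {w : InfinitePlace L // IsComplex w} => (⟨w.1.embedding ζ, mem_sphere_zero_iff_norm.mpr (hζn w)⟩ : Circle))
    Finset.univ rfl
  -- ★ (3G♭): the `G′`-side along the curve is flat (definite `w₀`)
  obtain ⟨r, hrd, hr, hreq⟩ := exists_flat_gSide_centralCurve_of_archSmooth L α' z₀ c₁ γHc γGc hγHc hγGc w₀ μω
    (T.comap Φ.toMulEquiv (isArchNormPair_of_archCongr L _ Φ hΦ) : ArchTransferFactor L (Matrix.diagonal α')) (ν'.map Φ.symm) (a' ∘ Φ)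
    hα' hαherm hreal hμu c hTΦ hc₀ hc₁' hcen hinj hw₀ ha'Φ
  -- ★ (E2) §2 at `S = univ`, `w₁ = w₀`, `r := κ⁻¹ • r`
  refine UnitaryGroup.sum_integral_pi_erase_eq_zero_of_eventuallyEq L (![(2 : L)⁻¹, -(2 : L)⁻¹]) νw
    (fun w : {w : InfinitePlace L // IsComplex w} => (⟨w.1.embedding ζ, mem_sphere_zero_iff_norm.mpr (hζn w)⟩ : Circle)) (UnitaryGroup.quasiSplitWeightsTwo_ne_zero (L := L)) Θ₂ hΘ hΘc
    Finset.univ w₀ (Finset.mem_univ w₀) (UnitaryGroup.im_embedding_quasiSplitWeightsTwo_eq_zero L w₀) (UnitaryGroup.re_embedding_quasiSplitWeightsTwo_mul_neg L w₀) u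
    (fun w _ hne => (hu w (Finset.mem_erase.2 ⟨hne, Finset.mem_univ w⟩)).1) (fun ψ => ((κ⁻¹ : ℝ) : ℂ) * r ψ) ?_ ?_ ?_
  · filter_upwards [hrd] with ψ hψ
    exact hψ.const_mul _
  · have hev : (fun ψ : ℝ => deriv (fun ψ : ℝ => ((κ⁻¹ : ℝ) : ℂ) * r ψ) ψ) =ᶠ[𝓝[≠] (0 : ℝ)] fun ψ => ((κ⁻¹ : ℝ) : ℂ) * deriv r ψ := by
      filter_upwards [hrd] with ψ hψ
      exact deriv_const_mul _ hψ
    rw [Filter.tendsto_congr' hev]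
    simpa only [mul_zero] using hr.const_mul ((κ⁻¹ : ℝ) : ℂ)
  · have hIoo : ∀ᶠ ψ : ℝ in 𝓝[≠] 0, ψ ∈ Ioo (-1 : ℝ) 1 ∧ ψ ≠ 0 :=
      Filter.inter_mem (mem_nhdsWithin_of_mem_nhds (Ioo_mem_nhds (by norm_num) (by norm_num))) self_mem_nhdsWithin
    filter_upwards [hreq, hIoo] with ψ hψr hψ
    -- the curve is `G`-regular at `ψ`: at `w₀` by ★ `mul_exp_ne_*`, elsewhere by `hinj`
    have hinjψ : ∀ w : {w : InfinitePlace L // IsComplex w}, Function.Injective (fun i : Fin 3 => z₀ w i * Circle.exp (![(1 : ℝ), 0, -1] i * (c₁ w * ψ))) := by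
      intro w
      by_cases hw : w = w₀
      · subst hw
        rw [hz₀w₀, hc1, one_mul]
        refine injective_of_pairwise_ne_three ?_ ?_ ?_
        · show _ * Circle.exp (1 * ψ) ≠ _ * Circle.exp (0 * ψ)
          rw [one_mul, zero_mul, Circle.exp_zero, mul_one]
          exact UnitaryGroup.mul_exp_ne_self _ hψ.1 hψ.2
        · show _ * Circle.exp (1 * ψ) ≠ _ * Circle.exp (-1 * ψ)
          rw [one_mul, neg_mul, one_mul]
          exact UnitaryGroup.mul_exp_ne_mul_exp_neg _ hψ.1 hψ.2
        · show _ * Circle.exp (0 * ψ) ≠ _ * Circle.exp (-1 * ψ)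
          rw [zero_mul, Circle.exp_zero, mul_one, neg_mul, one_mul]
          exact fun h => UnitaryGroup.mul_exp_neg_ne_self _ hψ.1 hψ.2 h.symm
      · have hc0 : c₁ w = 0 := hc₁' w hw
        have hfun : (fun i : Fin 3 => z₀ w i * Circle.exp (![(1 : ℝ), 0, -1] i * (c₁ w * ψ))) = z₀ w := by
          funext i
          rw [hc0, zero_mul, mul_zero, Circle.exp_zero, mul_one]
        rw [hfun]
        exact hinj w hw
    -- ★ (β) at `ψ` with the datum `u_ψ` and the integrand `o ↦ Θ₂ ↑↑(e⁻¹ o)` of ★ (E2)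
    have hU : ∀ w : {w : InfinitePlace L // IsComplex w},
        Function.update u w₀ ![(id ⟨w₀.1.embedding ζ, mem_sphere_zero_iff_norm.mpr (hζn w₀)⟩ : Circle) * Circle.exp ψ,
            (id ⟨w₀.1.embedding ζ, mem_sphere_zero_iff_norm.mpr (hζn w₀)⟩ : Circle) * Circle.exp (-ψ)] w =
          ![z₀ w 0 * Circle.exp (![(1 : ℝ), 0, -1] 0 * (c₁ w * ψ)), z₀ w 2 * Circle.exp (![(1 : ℝ), 0, -1] 2 * (c₁ w * ψ))] := by
      intro w
      by_cases hw : w = w₀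
      · subst hw
        rw [Function.update_self, hz₀w₀, hc1, one_mul]
        show _ = ![_ * Circle.exp (1 * ψ), _ * Circle.exp (-1 * ψ)]
        rw [one_mul, neg_mul, one_mul]
        rfl
      · rw [Function.update_of_ne hw, hz₀w w hw, hc₁' w hw, zero_mul, mul_zero, mul_zero, Circle.exp_zero, mul_one, mul_one]
        funext i
        fin_cases i <;> rfl
    have hF : ∀ o : ∀ w : {w : InfinitePlace L // IsComplex w}, UnitaryGroup.archLocal L 2 (Matrix.diagonal ![(2 : L)⁻¹, -(2 : L)⁻¹]) w,
        Θ₂ ((((UnitaryGroup.archPiEquivCM 2 L (Matrix.diagonal ![(2 : L)⁻¹, -(2 : L)⁻¹])).symm o :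
            UnitaryGroup.arch (↥(maximalRealSubfield L)) L (IsCMField.complexConj L) 2 (Matrix.diagonal ![(2 : L)⁻¹, -(2 : L)⁻¹])) : GL (Fin 2) (mixedSpace L)) : Matrix (Fin 2) (Fin 2) (mixedSpace L)) =
          aH (Ψ.symm ((UnitaryGroup.archPiEquivCM 2 L (Matrix.diagonal ![(2 : L)⁻¹, -(2 : L)⁻¹])).symm o), (γHc ψ).2) := by
      intro o
      rw [hΘa]
      congr 2
      -- the frozen coordinate: `e₁⁻¹ (w ↦ diag(σ_w ζ)) = (γHc ψ).2` (`s₁ = 0`, `z₀_w,1 = σ_w ζ`)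
      simp only [hγHc]
      congr 1
      funext w
      apply Subtype.ext
      show UnitaryGroup.circleDiagonal 1 _ = UnitaryGroup.circleDiagonal 1 _
      congr 1
      funext i
      fin_cases i
      have h1 : z₀ w 1 = (⟨w.1.embedding ζ, mem_sphere_zero_iff_norm.mpr (hζn w)⟩ : Circle) := by
        by_cases hw : w = w₀
        · subst hw; rw [hz₀w₀]; rfl
        · rw [hz₀w w hw]; rfl
      show (⟨w.1.embedding ζ, mem_sphere_zero_iff_norm.mpr (hζn w)⟩ : Circle) = z₀ w 1 * Circle.exp (0 * (c₁ w * ψ))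
      rw [zero_mul, Circle.exp_zero, mul_one, h1]
    have hβψ := hβ ψ _ _ hU hF hinjψ
    -- real scalars act on `ℂ` by multiplication (one normal form for the `•` of ★ (E2) and of ★ (3G♭))
    have hψr' := hψr
    simp only [Complex.real_smul] at hψr' ⊢
    rw [← hψr']
    refine (congrArg (fun x : ℂ => ((2 * Real.sin ψ : ℝ) : ℂ) * x) hβψ).trans ?_
    rw [mul_left_comm]

end Literature.NumberTheory.Rogawski1990

end
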